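import Summits.QuantumFields.YangMills.Theorems.CovariantDischargeDoorExponentRows
import HarnessLib

/-!
# Line «sandwich_discharge» on crux `HistoryTailL` (stmt-QuantumFields-19936), stub `stub_sandwichSweepGapCapped` (S′), B6 door — the `j₀` SLOT:
# «ONE DEPTH THRESHOLD FOR ALL ROWS»: the (η) rows in FACTOR × `θ` form, the smallness of each factor, and ★`exists_j0_door` — a single `j₀ ≥ m`
# past which the bulk, (r2)-defect, reading (both heights) and cost-defect factors are `≤ ε` and the geometric side condition `C_G·L^m ≤ L^j` holds

Cell `ym3-torus` (YM ladder rung R3 = continuum SU(2) Yang–Mills on the three-torus — a RUNG, NOT the Clay problem: not d = 4, not infinite volume,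
not a mass gap); WIDTH helper seat `ym3-torus-px6` gen 8; `--supports stmt-QuantumFields-19936` (helper).  THEOREMS ONLY (0 `def`, default heartbeats).

WHY (px8 g7 DOOR SKELETON OF RECORD 664c2d33, 13:20:11Z: «`obtain ⟨j₀, hj₀m, hj₀⟩ : ∃ j₀, m ≤ j₀ ∧ ∀ j, j₀ < j → (η-all)` … (η) slot = px6's», GEOM-3∕4
«`j₀ ≥ m + log_L(5N_R)` — add this to j₀'s rows»).  ✓`CovariantDischargeDoorExponentRows` bounds every remainder by `FACTOR(j)·θ` (signal rows) or
`FACTOR(j)` (cost rows) and proves each factor eventually small; THIS FILE packages them in the shape the skeleton's `obtain` consumes: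
* §1 three «eventually» combinators on `∃ j₀, ∀ j, j₀ < j → P j` (conjunction, `m ≤ j`, `C ≤ L^j` for `L ≥ 2`);
* §2 the (η1)(η2)(η3)(η3′) rows RESTATED as `LHS ≤ FACTOR(j) * θ` with the factor written exactly as §3 bounds it (`bulk_row_le'`, `defect_row_le'`,
  `reading_row_le'`, `reading_row_far_le'`; (η4) is already θ-free);
* §3 each factor `≤ ε` for `j > j₀` (`L ≥ 3`): `exists_forall_bulkFactor_le`, `…defectFactor…`, `…readFactor…`, `…readFarFactor…`, `…costFactor…`;
* §4 ★`exists_j0_door (hL : 3 ≤ L) … (hε : 0 < ε) : ∃ j₀, m ≤ j₀ ∧ ∀ j, j₀ < j → bulkF j ≤ ε ∧ defectF j ≤ ε ∧ readF j ≤ ε ∧ readFarF j ≤ ε ∧ costF j ≤ ε ∧ C_G·L^m ≤ L^j`,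
  and ★`exists_j0_door_nat` = the skeleton's slot VERBATIM (`N_R : ℕ`, guard `5·N_R < L^j₀` at the threshold).
HONEST SCOPE: real arithmetic ∕ `atTop` bookkeeping; NOTHING here proves the capped stub, `HistoryTailL`, or any summit statement; YM₃ on T³ is rung R3, not
Clay. [folklore]
-/

noncomputable section

namespace Summit.QuantumFields.YangMills.Theorems.CovariantDischargeDoorThresholdJ0

open Summit.QuantumFields.YangMills.Theorems.CovariantDischargeDoorExponentRows

/-! ## §1 «Eventually in `j`» combinators -/

/-- Conjunction of two eventual properties. [folklore] -/
theorem eventually_and {P Q : ℕ → Prop} (hP : ∃ j₀ : ℕ, ∀ j, j₀ < j → P j) (hQ : ∃ j₀ : ℕ, ∀ j, j₀ < j → Q j) :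
    ∃ j₀ : ℕ, ∀ j, j₀ < j → P j ∧ Q j := by
  obtain ⟨a, ha⟩ := hP
  obtain ⟨b, hb⟩ := hQ
  exact ⟨max a b, fun j hj => ⟨ha j (lt_of_le_of_lt (le_max_left a b) hj), hb j (lt_of_le_of_lt (le_max_right a b) hj)⟩⟩

/-- An eventual property stays eventual after raising the threshold to any `m`. [folklore] -/
theorem eventually_from {P : ℕ → Prop} (m : ℕ) (hP : ∃ j₀ : ℕ, ∀ j, j₀ < j → P j) : ∃ j₀ : ℕ, m ≤ j₀ ∧ ∀ j, j₀ < j → P j := by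
  obtain ⟨a, ha⟩ := hP
  exact ⟨max a m, le_max_right a m, fun j hj => ha j (lt_of_le_of_lt (le_max_left a m) hj)⟩

/-- Powers of `L ≥ 2` eventually dominate any constant: `∃ j₀, ∀ j > j₀, C ≤ L^j`. [folklore] -/
theorem eventually_const_le_pow {L : ℕ} (hL : 2 ≤ L) (C : ℝ) : ∃ j₀ : ℕ, ∀ j, j₀ < j → C ≤ (L : ℝ) ^ j := by
  have hL1 : (1 : ℝ) < L := by exact_mod_cast (lt_of_lt_of_le one_lt_two hL)
  obtain ⟨j₀, hj₀⟩ := pow_unbounded_of_one_lt C hL1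
  refine ⟨j₀, fun j hj => hj₀.le.trans ?_⟩
  exact pow_le_pow_right₀ hL1.le hj.le

/-! ## §2 The signal rows in FACTOR × `θ` form -/

section Factor

variable {L : ℕ} {p₀ θ x θK R N_R : ℝ} {j m h : ℕ}

/-- (η1) in factor form: `bulk ≤ (1888√3·(A_B + A_B′)·N_R³·4^{p₀}·L^(3m)·151^j∕L^(7j)) · θ`. [folklore] -/
theorem bulk_row_le' (hL : 1 ≤ L) (hθ : 0 ≤ θ) (hθx : θ ≤ x) (hθK0 : 0 ≤ θK) (hθK : θK ≤ (2 : ℝ) ^ p₀ * Real.sqrt ((L : ℝ)⁻¹) ^ j * θ)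
    (hx : x ≤ (151 * (L : ℝ) ^ 2 * ((L : ℝ)⁻¹) ^ 19) ^ j) (hNR : 1 ≤ N_R) (hh : h = j + m) (hR : R = N_R * (L : ℝ) ^ (2 * j + h))
    {A_B A_B' : ℝ} (hAB : 0 ≤ A_B) (hAB' : 0 ≤ A_B') :
    Real.sqrt 3 * (60 * θK ^ 2 + 6 * (49 * R ^ 2 * θK) * θK) / 3 * (A_B + A_B' * (2 * R + 2 * (L : ℝ) ^ h)) * (4 * (L : ℝ) ^ (2 * j))
      ≤ (1888 * Real.sqrt 3 * (A_B + A_B') * (N_R ^ 3 * (4 : ℝ) ^ p₀ * (L : ℝ) ^ (3 * m)) * (151 : ℝ) ^ j / (L : ℝ) ^ (7 * j)) * θ := by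
  refine (bulk_row_le hL hθ hθx hθK0 hθK hx hNR hh hR hAB hAB').trans (le_of_eq ?_)
  ring

/-- (η2) in factor form: `defect ≤ (10816·A₁·N_R³·4^{p₀}·L^(3m)·151^j∕L^(7j)) · θ`. [folklore] -/
theorem defect_row_le' (hL : 1 ≤ L) (hθ : 0 ≤ θ) (hθx : θ ≤ x) (hθK0 : 0 ≤ θK) (hθK : θK ≤ (2 : ℝ) ^ p₀ * Real.sqrt ((L : ℝ)⁻¹) ^ j * θ)
    (hx : x ≤ (151 * (L : ℝ) ^ 2 * ((L : ℝ)⁻¹) ^ 19) ^ j) (hNR : 1 ≤ N_R) (hh : h = j + m) (hR : R = N_R * (L : ℝ) ^ (2 * j + h))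
    {A₁ : ℝ} (hA₁ : 0 ≤ A₁) :
    2 * θK * (2 * 16 * 169 * R ^ 2 * θK * A₁ * R * (L : ℝ) ^ (2 * j))
      ≤ (10816 * A₁ * (N_R ^ 3 * (4 : ℝ) ^ p₀ * (L : ℝ) ^ (3 * m)) * (151 : ℝ) ^ j / (L : ℝ) ^ (7 * j)) * θ := by
  refine (defect_row_le hL hθ hθx hθK0 hθK hx hNR hh hR hA₁).trans (le_of_eq ?_)
  ring

/-- (η3) in factor form: `E_j ≤ (3062500√3·4^{p₀}·60400^j∕L^(12j)) · θ`. [folklore] -/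
theorem reading_row_le' (hL : 1 ≤ L) (hθ : 0 ≤ θ) (hθx : θ ≤ x) (hθK0 : 0 ≤ θK) (hθK : θK ≤ (2 : ℝ) ^ p₀ * Real.sqrt ((L : ℝ)⁻¹) ^ j * θ)
    (hx : x ≤ (151 * (L : ℝ) ^ 2 * ((L : ℝ)⁻¹) ^ 19) ^ j) :
    100 * Real.sqrt 3 * (20 * (L : ℝ)) ^ (2 * j) * (175 * (L : ℝ) ^ (2 * j) * θK) ^ 2
      ≤ (3062500 * Real.sqrt 3 * ((4 : ℝ) ^ p₀ * 1) * (60400 : ℝ) ^ j / (L : ℝ) ^ (12 * j)) * θ := by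
  refine (reading_row_le hL hθ hθx hθK0 hθK hx).trans (le_of_eq ?_)
  ring

/-- (η3′) in factor form: `(L^(2m))⁻¹·E_h ≤ (3062500√3·(4^{p₀}·400^m·L^(4m))·60400^j∕L^(12j)) · θ`. [folklore] -/
theorem reading_row_far_le' (hL : 1 ≤ L) (hθ : 0 ≤ θ) (hθx : θ ≤ x) (hθK0 : 0 ≤ θK) (hθK : θK ≤ (2 : ℝ) ^ p₀ * Real.sqrt ((L : ℝ)⁻¹) ^ j * θ)
    (hx : x ≤ (151 * (L : ℝ) ^ 2 * ((L : ℝ)⁻¹) ^ 19) ^ j) (hh : h = j + m) :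
    ((L : ℝ) ^ (2 * m))⁻¹ * (100 * Real.sqrt 3 * (20 * (L : ℝ)) ^ (2 * h) * (175 * (L : ℝ) ^ (2 * h) * θK) ^ 2)
      ≤ (3062500 * Real.sqrt 3 * ((4 : ℝ) ^ p₀ * (400 : ℝ) ^ m * (L : ℝ) ^ (4 * m)) * (60400 : ℝ) ^ j / (L : ℝ) ^ (12 * j)) * θ := by
  refine (reading_row_far_le hL hθ hθx hθK0 hθK hx hh).trans (le_of_eq ?_)
  ring

/-- (η4) in factor form (already θ-free): `cost-defect ≤ 9139520·A_T·A₁·(N_R⁵·4^{p₀}·L^(5m))·22801^j∕L^(17j)`. [folklore] -/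
theorem cost_defect_row_le' (hL : 1 ≤ L) (hθ : 0 ≤ θ) (hθx : θ ≤ x) (hθK0 : 0 ≤ θK) (hθK : θK ≤ (2 : ℝ) ^ p₀ * Real.sqrt ((L : ℝ)⁻¹) ^ j * θ)
    (hx : x ≤ (151 * (L : ℝ) ^ 2 * ((L : ℝ)⁻¹) ^ 19) ^ j) (hNR : 1 ≤ N_R) (hh : h = j + m) (hR : R = N_R * (L : ℝ) ^ (2 * j + h))
    {A_T A₁ : ℝ} (hAT : 0 ≤ A_T) (hA₁ : 0 ≤ A₁) :
    320 * A_T * A₁ * (169 * R ^ 2 * θK) ^ 2 * R * (L : ℝ) ^ (4 * j) / (L : ℝ) ^ j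
      ≤ 9139520 * A_T * A₁ * (N_R ^ 5 * (4 : ℝ) ^ p₀ * (L : ℝ) ^ (5 * m)) * (22801 : ℝ) ^ j / (L : ℝ) ^ (17 * j) := by
  refine (cost_defect_row_le hL hθ hθx hθK0 hθK hx hNR hh hR hAT hA₁).trans (le_of_eq ?_)
  ring

end Factor

/-! ## §3 Each factor is eventually `≤ ε` -/

section Small

variable {L : ℕ}

/-- Bulk factor `≤ ε` for `j > j₀`. [folklore] -/
theorem exists_forall_bulkFactor_le (hL : 3 ≤ L) (A_B A_B' N_R p₀ : ℝ) (m : ℕ) {ε : ℝ} (hε : 0 < ε) :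
    ∃ j₀ : ℕ, ∀ j : ℕ, j₀ < j →
      1888 * Real.sqrt 3 * (A_B + A_B') * (N_R ^ 3 * (4 : ℝ) ^ p₀ * (L : ℝ) ^ (3 * m)) * (151 : ℝ) ^ j / (L : ℝ) ^ (7 * j) ≤ ε :=
  exists_forall_row_le hL (by norm_num) gamma_facts.1 _ _ hε

/-- Defect factor `≤ ε` for `j > j₀`. [folklore] -/
theorem exists_forall_defectFactor_le (hL : 3 ≤ L) (A₁ N_R p₀ : ℝ) (m : ℕ) {ε : ℝ} (hε : 0 < ε) :
    ∃ j₀ : ℕ, ∀ j : ℕ, j₀ < j → 10816 * A₁ * (N_R ^ 3 * (4 : ℝ) ^ p₀ * (L : ℝ) ^ (3 * m)) * (151 : ℝ) ^ j / (L : ℝ) ^ (7 * j) ≤ ε :=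
  exists_forall_row_le hL (by norm_num) gamma_facts.1 _ _ hε

/-- Reading factor (height `j`) `≤ ε` for `j > j₀`. [folklore] -/
theorem exists_forall_readFactor_le (hL : 3 ≤ L) (p₀ : ℝ) {ε : ℝ} (hε : 0 < ε) :
    ∃ j₀ : ℕ, ∀ j : ℕ, j₀ < j → 3062500 * Real.sqrt 3 * ((4 : ℝ) ^ p₀ * 1) * (60400 : ℝ) ^ j / (L : ℝ) ^ (12 * j) ≤ ε :=
  exists_forall_row_le hL (by norm_num) gamma_facts.2.1 _ _ hε

/-- Reading factor (far height) `≤ ε` for `j > j₀`. [folklore] -/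
theorem exists_forall_readFarFactor_le (hL : 3 ≤ L) (p₀ : ℝ) (m : ℕ) {ε : ℝ} (hε : 0 < ε) :
    ∃ j₀ : ℕ, ∀ j : ℕ, j₀ < j →
      3062500 * Real.sqrt 3 * ((4 : ℝ) ^ p₀ * (400 : ℝ) ^ m * (L : ℝ) ^ (4 * m)) * (60400 : ℝ) ^ j / (L : ℝ) ^ (12 * j) ≤ ε :=
  exists_forall_row_le hL (by norm_num) gamma_facts.2.1 _ _ hε

/-- Cost-defect factor `≤ ε` for `j > j₀`. [folklore] -/
theorem exists_forall_costFactor_le (hL : 3 ≤ L) (A_T A₁ N_R p₀ : ℝ) (m : ℕ) {ε : ℝ} (hε : 0 < ε) :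
    ∃ j₀ : ℕ, ∀ j : ℕ, j₀ < j → 9139520 * A_T * A₁ * (N_R ^ 5 * (4 : ℝ) ^ p₀ * (L : ℝ) ^ (5 * m)) * (22801 : ℝ) ^ j / (L : ℝ) ^ (17 * j) ≤ ε :=
  exists_forall_row_le hL (by norm_num) gamma_facts.2.2 _ _ hε

end Small

/-! ## §4 ★ One `j₀` for the door -/

/-- ★ **ONE DEPTH THRESHOLD FOR ALL ROWS.**  For `L ≥ 3`, the profile constants, `p₀`, the far offset `m`, the radius factor `N_R`, a geometric
constant `C_G` and `ε > 0`, there is `j₀ ≥ m` such that for every `j > j₀` the bulk, (r2)-defect, reading (both heights) and cost-defect FACTORS are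
`≤ ε` and `C_G·L^m ≤ L^j` — the shape of the DOOR SKELETON's `obtain ⟨j₀, hj₀m, hj₀⟩`. [folklore] -/
theorem exists_j0_door {L : ℕ} (hL : 3 ≤ L) (A_B A_B' A₁ A_T N_R p₀ C_G : ℝ) (m : ℕ) {ε : ℝ} (hε : 0 < ε) :
    ∃ j₀ : ℕ, m ≤ j₀ ∧ ∀ j : ℕ, j₀ < j →
      1888 * Real.sqrt 3 * (A_B + A_B') * (N_R ^ 3 * (4 : ℝ) ^ p₀ * (L : ℝ) ^ (3 * m)) * (151 : ℝ) ^ j / (L : ℝ) ^ (7 * j) ≤ ε ∧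
      10816 * A₁ * (N_R ^ 3 * (4 : ℝ) ^ p₀ * (L : ℝ) ^ (3 * m)) * (151 : ℝ) ^ j / (L : ℝ) ^ (7 * j) ≤ ε ∧
      3062500 * Real.sqrt 3 * ((4 : ℝ) ^ p₀ * 1) * (60400 : ℝ) ^ j / (L : ℝ) ^ (12 * j) ≤ ε ∧
      3062500 * Real.sqrt 3 * ((4 : ℝ) ^ p₀ * (400 : ℝ) ^ m * (L : ℝ) ^ (4 * m)) * (60400 : ℝ) ^ j / (L : ℝ) ^ (12 * j) ≤ ε ∧
      9139520 * A_T * A₁ * (N_R ^ 5 * (4 : ℝ) ^ p₀ * (L : ℝ) ^ (5 * m)) * (22801 : ℝ) ^ j / (L : ℝ) ^ (17 * j) ≤ ε ∧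
      C_G * (L : ℝ) ^ m ≤ (L : ℝ) ^ j := by
  have hL2 : 2 ≤ L := le_trans (by norm_num) hL
  exact eventually_from m
    (eventually_and (exists_forall_bulkFactor_le hL A_B A_B' N_R p₀ m hε)
      (eventually_and (exists_forall_defectFactor_le hL A₁ N_R p₀ m hε)
        (eventually_and (exists_forall_readFactor_le hL p₀ hε)
          (eventually_and (exists_forall_readFarFactor_le hL p₀ m hε)
            (eventually_and (exists_forall_costFactor_le hL A_T A₁ N_R p₀ m hε)
              (eventually_const_le_pow hL2 (C_G * (L : ℝ) ^ m)))))))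


/-- ★★ **THE SKELETON's SLOT, VERBATIM SHAPE** (px8 g7 DOOR SKELETON :122, `N_R : ℕ`, geometric guard IN `ℕ` AT THE THRESHOLD; px7 g8 13:30:49Z socket
certificate): `∃ j₀, m ≤ j₀ ∧ 5·N_R < L^j₀ ∧ ∀ j > j₀, (the five factor rows ≤ ε)` (`L ≥ 3`). [folklore] -/
theorem exists_j0_door_nat {L : ℕ} (hL : 3 ≤ L) (A_B A_B' A₁ A_T p₀ : ℝ) (N_R m : ℕ) {ε : ℝ} (hε : 0 < ε) :
    ∃ j₀ : ℕ, m ≤ j₀ ∧ 5 * N_R < L ^ j₀ ∧ ∀ j : ℕ, j₀ < j →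
      1888 * Real.sqrt 3 * (A_B + A_B') * ((N_R : ℝ) ^ 3 * (4 : ℝ) ^ p₀ * (L : ℝ) ^ (3 * m)) * (151 : ℝ) ^ j / (L : ℝ) ^ (7 * j) ≤ ε ∧
      10816 * A₁ * ((N_R : ℝ) ^ 3 * (4 : ℝ) ^ p₀ * (L : ℝ) ^ (3 * m)) * (151 : ℝ) ^ j / (L : ℝ) ^ (7 * j) ≤ ε ∧
      3062500 * Real.sqrt 3 * ((4 : ℝ) ^ p₀ * 1) * (60400 : ℝ) ^ j / (L : ℝ) ^ (12 * j) ≤ ε ∧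
      3062500 * Real.sqrt 3 * ((4 : ℝ) ^ p₀ * (400 : ℝ) ^ m * (L : ℝ) ^ (4 * m)) * (60400 : ℝ) ^ j / (L : ℝ) ^ (12 * j) ≤ ε ∧
      9139520 * A_T * A₁ * ((N_R : ℝ) ^ 5 * (4 : ℝ) ^ p₀ * (L : ℝ) ^ (5 * m)) * (22801 : ℝ) ^ j / (L : ℝ) ^ (17 * j) ≤ ε := by
  obtain ⟨j₀, hm, hj₀⟩ := exists_j0_door hL A_B A_B' A₁ A_T (N_R : ℝ) p₀ (5 * (N_R : ℝ) + 1) m hε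
  have hL3 : (3 : ℝ) ≤ L := by exact_mod_cast hL
  have hL1 : (1 : ℝ) ≤ L := by linarith
  refine ⟨j₀ + 1, Nat.le_succ_of_le hm, ?_, fun j hj => ?_⟩
  · -- the geometric conjunct at `j := j₀ + 1`
    have hgeo := (hj₀ (j₀ + 1) (Nat.lt_succ_self j₀)).2.2.2.2.2
    have hLm : (1 : ℝ) ≤ (L : ℝ) ^ m := one_le_pow₀ hL1
    have h1 : (5 * (N_R : ℝ) + 1) ≤ (5 * (N_R : ℝ) + 1) * (L : ℝ) ^ m := le_mul_of_one_le_right (by positivity) hLm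
    have h2 : (5 * (N_R : ℝ) + 1) ≤ (L : ℝ) ^ (j₀ + 1) := h1.trans hgeo
    have h3 : ((5 * N_R : ℕ) : ℝ) < ((L ^ (j₀ + 1) : ℕ) : ℝ) := by push_cast; linarith
    exact_mod_cast h3
  · obtain ⟨h1, h2, h3, h4, h5, _⟩ := hj₀ j ((Nat.lt_succ_self j₀).trans hj)
    exact ⟨h1, h2, h3, h4, h5⟩

end Summit.QuantumFields.YangMills.Theorems.CovariantDischargeDoorThresholdJ0

end
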